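import Summits.BirchSwinnertonDyer.BirchSwinnertonDyer.Theorems.PrintX9HowardContainmentLightFrameOfPrintOfNonvanishing
import Summits.BirchSwinnertonDyer.BirchSwinnertonDyer.Theorems.PrintX9HowardContainmentLightFramePinnedOfPrintSharpOfMuCoherentPair
import Summits.BirchSwinnertonDyer.BirchSwinnertonDyer.Theorems.PrintX9StabilizedClassOfKolyvaginSystemLeaf
import Summits.BirchSwinnertonDyer.BirchSwinnertonDyer.Theorems.PrintX9AssemblyLightFramePinned
import Summits.BirchSwinnertonDyer.BirchSwinnertonDyer.Theorems.PrintX9TwoSidedLinkPinnedOfPrint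
import HarnessLib

/-!
# The light Howard containments of row 9 WITHOUT the leaf `CGLSHeegnerClassNonvanishing` (stmt-27103):
# the non-vanishing of the `Λ`-adic stabilised class `κ_∞` of the COHERENT datum is already inside the
# `closes`-binder `CGLSHeegnerKolyvaginSystem` (F-411, CGLS 2022 Thm. 4.1.1 in Kolyvagin-system form)

Cell `pub/bsd-print-x9`, seat `bsd-line-x9-p1` (LEAD g7), write-crux stmt-BirchSwinnertonDyer-25235
`HowardContainmentLightFrameOfPrint` (aside r203; skeleton v4 closes it modulo the cite-only leaf 27103).

FINDING (kernel, this file). The leaf `CGLSHeegnerClassNonvanishing` (27103; CGLS 2022 Thm. 4.1.1 as a `∀ (D, C)` value: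
`𝔖` torsion-free ∧ `Λκ_∞(C) ≠ ⊥` ∧ `𝔖/Λκ_∞(C)` torsion) is consumed by every row-9 closer ONLY at the cell's COHERENT
stabilised datum `C₀` (the envelope engine's), and there it is REDUNDANT given two binders `PrintX9.closes` already carries:
* `CGLSHeegnerKolyvaginSystem` (`hK`, F-411 = `CastellaGrossiLeeSkinner2022.thm411_exists_kolyvaginSystem_one_ne_zero`): for
  every `(D, C, z)` with `proj_k z = δ(κ_k(C))` above the torsion depth it yields a Kolyvagin system with `κ.one ≠ 0` on the
  `Λ`-line of `Φ′(z)`, hence `z ≠ 0` (the tree's `WeierstrassCurve.ne_zero_of_thm411`, μ-LEAD g4, with its presentation slots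
  filled here by tree data: tame pins `nonempty_tamePin`, the conjugation datum `ConjugationDatum.ofLifts` of an imaginary
  quadratic field, the source H.4 data `shapiroDualityDataUnitTwist`);
* `CGSHowardDivisibilityPLocalized` (`hCGS`, CGS 2025 Thm. 6.5.2) resp. `CGLSHowardDivisibilityLocalized` (CGLS Thm. 4.1.3):
  `𝔖` finitely generated of `Λ`-rank one;
and the kernel: `𝔖` torsion-free from `E(K)[p] = 0` (`LambdaAdicSelmerData.noZeroSMulDivisors_of_noPTorsion`, p645741), the
engine's class `z = κ_∞ ∈ 𝔖` with `proj_k κ_∞ = δ(κ_k)` and `Λκ_∞(C₀) = Λ ∙ κ_∞` (`exists_coherent_pair_envelope_class`, x9-p2),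
rank–nullity (`PrintX9Binders.noZeroSMulDivisors_and_isTorsion_quotient_of_finrank_eq_one`, x9-p2 g3).

WHAT.
* (§1 lives in the ROUTE-FREE core `Theorems/PrintX9StabilizedClassOfKolyvaginSystemLeaf.lean`, ns `HeegnerStabilizedOfKSLeaf`:
  `stabilizedClass_ne_zero_of_kolyvaginSystemLeaf` (F-411 ⟹ `z ≠ 0`), `torsionFree_and_isTorsion_quotient_of_kolyvaginSystemLeaf`
  (+ `Λκ_∞(C) = Λ ∙ z` + `finrank_Λ 𝔖 = 1` ⟹ torsion-free ∧ torsion) and the coherent-pair μ-letter with its torsion clause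
  DERIVED, `exists_coherentPair_isTorsion_muIneq_of_howard_kolyvaginSystem` — shared with the X10b twin.)
* §2 `package_of_envelopeModules_of_isTorsion`: the localized package of `PrintX9OfPrintNonvanishing.package_of_envelopeModules_of_thm413`
  (LEAD g5) with the torsion of `𝔖 ⧸ Λκ_∞(C)` as a HYPOTHESIS instead of the leaf.
* §3 THE UNTIED SIDE (items 24424 / 25235): `howardContainmentLightFrame_of_kolyvaginSystemLeaf_of_cgls :
  CGLSHeegnerKolyvaginSystem → CGLSHowardDivisibilityLocalized → HowardContainmentLightFrame` and
  **`howardContainmentLightFrameOfPrint_of_kolyvaginSystemLeaf : CGLSHeegnerKolyvaginSystem → HowardContainmentLightFrameOfPrint`**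
  — the write-crux 25235 modulo the `closes`-binder F-411 ALONE (LEAD g5's closer p681863 needed the extra leaf 27103).
* §4 THE PINNED SIDE (route currency, item 26356 `HowardContainmentLightFramePinned` and the deciding crux 27077
  `HowardContainmentLightFramePinnedOfPrintSharp := hMZ → hNV → hCGS → hTw♯ → A^pin`):
  **`howardContainmentLightFramePinned_of_howard_kolyvaginSystem_mz_cgs :
  HowardDVRKolyvaginBound → CGLSHeegnerKolyvaginSystem → MastellaZermanHowardDivisibility → CGSHowardDivisibilityPLocalized →
  HowardContainmentLightFramePinned`** (four cite-only print leaves, all of them `closes` binders; NO `hNV`, NO `hCG`, the sharp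
  tower and the frame-restricted Kummer = strict letter being kernel theorems) and the by-name form
  `howardContainmentLightFramePinnedOfPrintSharp_of_howard_kolyvaginSystem :
  HowardDVRKolyvaginBound → CGLSHeegnerKolyvaginSystem → HowardContainmentLightFramePinnedOfPrintSharp` (`hNV`, `hTw` idle).
  Proof of the `p ∣ h_K` branch: the core's strengthened μ-letter (engine's coherent pair WITH CLASS `(C₀, F₀, κ_∞)`; `κ_∞ ≠ 0`
  from F-411; the specialised witnesses at `(D, C₀, X, κ_∞)` by the landed KS-port `HeegnerMuPartOfPrintKS.portCyclic_of_ks` with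
  the kernel letters of CG-FRAME; `lengthAt_torsion_le_two_mul_of_hasSpecWitnesses`), `Λ`-rank one and finiteness from `hCGS` at
  `(D, C₀, X)`, then p624590 §2 verbatim (forward envelope, CGS 6.5.2 p-localized containment, promotion). The `p ∤ h_K` branch
  is `PrintX9Rung.stmt_coprimeTied hMZ` (MZ26 Cor. 4.6).
* §5 DISPLAY: **`bsdpOnClassX9_of_sevenLeaves`** — the X9 leaf `Rank1Residual.BSDpOnClassX9` from SEVEN cite-only print leaves
  (F-161, F-411, `hMZ`, `hCGS`, `hPT`, `hHP`, `hCP`) and the two K6 μ-inputs (`MuTransfer`, `AnalyticMuZeroX9`) — the term of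
  `PrintX9.closes` with the landed closers of `hAsm` (p596936) and `hB` (T-G′) and §4 in place of `hG hM hH hK hCG hMZ hNV hCGS hTw`
  (compare `PrintX9LeafOfPrintLeaves.bsdpOnClassX9_of_nineLeaves`: minus `hCG`, minus `hNV`).

CONSEQUENCE for the pen / referee (no route verb here): in `PrintX9.closes` the binder `hNV : CGLSHeegnerClassNonvanishing`
(27103) is ELIMINABLE — `hG hM hH hK hCG hMZ hNV hCGS hTw` can be replaced by §4 applied to `hH hK hMZ hCGS`; the row-9
trust base loses the leaf whose `∀ C` typing over-ranges print's datum (REF Q-C / dossier §52) and keeps F-411, whose `∀ (C, z)`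
premiss is print's datum exactly (a `z` with `proj_k z = δ(κ_k(C))`).  The analogous X10b statement is not touched here.

HONEST FRAMING: every theorem is CONDITIONAL on the named print leaves it lists (statement-only Literature facts); nothing
is asserted about them; no item is closed by this file as typed (25235 stays open: its own three binders do not suffice —
LEAD g5 census); «beyond-print theorem»: no.  No summit statement is proved; BSD is NOT proved by any of this.

References: [CastellaGrossiLeeSkinner2022] Thm. 4.1.1, Rem. 4.1.4 (last sentence), Thm. 4.1.3, Cor. 3.4.2;
[CastellaGrossiSkinner2025] Thm. 6.5.2; [Howard2004HeegnerKolyvagin] Thm. 1.6.1, §1.3, proof of Thm. 2.2.10, §3.3, Thm. B;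
[MastellaZerman2026] Cor. 4.6; [PerrinRiou1987BSMF] §1 p. 405, §3.4 Prop. 10.
-/

set_option linter.dupNamespace false
set_option autoImplicit false

noncomputable section

open scoped Classical Pointwise NumberField
open Field IsDedekindDomain
open Literature Literature.NumberTheory.EllipticCurves WeierstrassCurve
  Literature.NumberTheory.EllipticCurves.ModularForms
  Literature.NumberTheory.EllipticCurves.CastellaGrossiLeeSkinner2022
  Literature.NumberTheory.GaloisCohomology.Howard2004 Literature.NumberTheory.GaloisRepresentations
open Summit.BirchSwinnertonDyer.BirchSwinnertonDyer.Theses.PrintX9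
open Summit.BirchSwinnertonDyer.BirchSwinnertonDyer.Theorems

namespace Summit.BirchSwinnertonDyer.BirchSwinnertonDyer.Theorems.PrintX9OfKolyvaginSystemLeaf

/-! ## §2 The localized package with the torsion of `𝔖 ⧸ Λκ_∞(C)` as a hypothesis -/

/-- Ideal bookkeeping: `(a) · ((b) · I)² = (a·b²) · I²`. [folklore] -/
private theorem span_singleton_mul_sq {R : Type*} [CommSemiring R] (a b : R) (I : Ideal R) :
    Ideal.span {a} * (Ideal.span {b} * I) ^ 2 = Ideal.span {a * b ^ 2} * I ^ 2 := by
  rw [mul_pow, Ideal.span_singleton_pow, ← mul_assoc, Ideal.span_singleton_mul_span_singleton]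

/-- **The localized package from the module-level envelope, the torsion of `𝔖 ⧸ Λκ_∞(C)` (hypothesis) and CGLS Thm. 4.1.3
at Selmer corank one BY NAME** — `PrintX9OfPrintNonvanishing.package_of_envelopeModules_of_thm413` with its ONE use of the
leaf `CGLSHeegnerClassNonvanishing` replaced by the hypothesis `htorC`.
[cite: CastellaGrossiLeeSkinner2022, Thm. 4.1.3 ("Moreover") with Cor. 3.4.2, Rem. 4.1.4] -/
theorem package_of_envelopeModules_of_isTorsion
    {W : WeierstrassCurve ℚ} [W.IsGloballyMinimal] {p : ℕ} [Fact p.Prime] [NeZero (W.conductorNorm ℤ)]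
    {K : Type} [Field K] [NumberField K] {κ : ZpExtension K p} {γ : Field.absoluteGaloisGroup K}
    {jbar : AlgebraicClosure K →+* ℂ}
    (h413 : thm413_rankOne_charIdeal_torsion_dvd_localized.{0})
    (hyp : Thm413Hypotheses (W.conductorNorm ℤ) W K p κ γ) (hrk : (W.baseChange K).selmerCorank p = 1)
    (D : (W.baseChange K).LambdaAdicSelmerData κ γ) (C : StabilizedHeegnerData (W.conductorNorm ℤ) W K κ jbar)
    (F : HeegnerFamily (W.conductorNorm ℤ) W K κ jbar) (X : (W.baseChange K).SelmerDualData κ γ)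
    {e : ℕ} {g : IwasawaAlgebra p} (hg : g ≠ 0)
    (hfwd : ((p : IwasawaAlgebra p) ^ e) • heegnerModule D F ≤ stabilizedHeegnerModule D C)
    (hrev : g • stabilizedHeegnerModule D C ≤ heegnerModule D F)
    (htorC : Module.IsTorsion (IwasawaAlgebra p) (D.S ⧸ stabilizedHeegnerModule D C)) :
    Module.Finite (IwasawaAlgebra p) D.S ∧ Module.finrank (IwasawaAlgebra p) D.S = 1 ∧
      Module.IsTorsion (IwasawaAlgebra p) (D.S ⧸ heegnerModule D F) ∧
      ∃ m : ℕ, Ideal.span {((p : IwasawaAlgebra p) ^ m)} * heegnerCharIdeal D F ^ 2 ≤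
        Module.charIdeal (IwasawaAlgebra p) (Submodule.torsion (IwasawaAlgebra p) X.X) := by
  obtain ⟨⟨hSfin, hS1⟩, -⟩ := h413 (W.conductorNorm ℤ) W K p κ γ jbar hyp D C X
  haveI := hSfin
  have htorF : Module.IsTorsion (IwasawaAlgebra p) (D.S ⧸ heegnerModule D F) :=
    isTorsion_quotient_heegnerModule_of_smul_stabilizedHeegnerModule_le D F C hg hrev htorC
  obtain ⟨n, henv⟩ :=
    exists_span_pow_mul_heegnerCharIdeal_le_stabilizedHeegnerCharIdeal_of_pow_smul_le D F C e hfwd htorF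
  obtain ⟨m, hm⟩ := span_pow_mul_sq_le_charIdeal_torsion_of_thm413 h413 hyp hrk D C X
  refine ⟨hSfin, hS1, htorF, m + n * 2, ?_⟩
  calc Ideal.span {((p : IwasawaAlgebra p) ^ (m + n * 2))} * heegnerCharIdeal D F ^ 2
      = Ideal.span {((p : IwasawaAlgebra p) ^ m)} *
          (Ideal.span {((p : IwasawaAlgebra p) ^ n)} * heegnerCharIdeal D F) ^ 2 := by
        rw [span_singleton_mul_sq, ← pow_mul, ← pow_add]
    _ ≤ Ideal.span {((p : IwasawaAlgebra p) ^ m)} * stabilizedHeegnerCharIdeal D C ^ 2 :=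
        Ideal.mul_mono_right (Ideal.pow_right_mono henv 2)
    _ ≤ _ := hm

/-! ## §3 The untied side: items 24424 / 25235 modulo F-411 (and CGLS Thm. 4.1.3) only -/

/-- **`HowardContainmentLightFrame` (stmt-BirchSwinnertonDyer-24424) from F-411, the sharp tower and CGLS Thm. 4.1.3** —
LEAD g5's `howardContainmentLightFrame_of_nonvanishing_of_towerSharp_of_cgls` with the engine run WITH ITS CLASS
(`exists_coherent_pair_envelope_class`) and the leaf `CGLSHeegnerClassNonvanishing` replaced by §1 (`κ_∞ ≠ 0` from F-411,
torsion by rank one from CGLS Thm. 4.1.3 (i)); the μ-blind promotion is the landed `PrintX9Rescaling.stub_rescaling`.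
Kernel-valid AS TYPED; not route currency (PIN-1 / R0).
[cite: CastellaGrossiLeeSkinner2022, Thm. 4.1.1 (KS form), Thm. 4.1.3, Cor. 3.4.2, Rem. 4.1.4]
[cite: Howard2004HeegnerKolyvagin, §3.3, Thm. B] [cite: PerrinRiou1987BSMF, §3.4 Prop. 10] -/
theorem howardContainmentLightFrame_of_kolyvaginSystemLeaf_of_towerSharp_of_cgls :
    CGLSHeegnerKolyvaginSystem → AnticyclotomicTowerSharp → CGLSHowardDivisibilityLocalized →
      HowardContainmentLightFrame := by
  intro hKS hTw hCGLS W _ _ p _ _ K _ _ hX9 hK hodd h3 hHN hHp hirr κ hκ γ hγ Dt H ιC hrk hfin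
  letI : Algebra K ℂ := ιC.toAlgebra
  let jbar : AlgebraicClosure K →+* ℂ :=
    (IsAlgClosed.lift (R := K) (M := ℂ) (S := AlgebraicClosure K)).toRingHom
  have hp : p.Prime := Fact.out
  have hX9' := Summit.BirchSwinnertonDyer.BirchSwinnertonDyer.Rank1Residual.classX9_census_of_classX9 W p hX9
  have hp_odd : Odd p := hp.odd_of_ne_two hX9'.ne_two
  have hyp := Summit.BirchSwinnertonDyer.Rank1Residual.X9.thm413Hypotheses_of_lightFrame hX9' hK hodd h3 hHN hHp
    hκ hγ
  -- the data `𝔖`, `X`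
  obtain ⟨D⟩ := LambdaAdicSelmerDataExists.nonempty_lambdaAdicSelmerData (W.baseChange K) p κ hγ
  obtain ⟨X⟩ := (W.baseChange K).nonempty_selmerDualData_holds κ γ hγ
  -- the coherent pair on `(Dt, H.β)` with its module-level envelope AND its class `κ_∞`
  obtain ⟨C, F₀, -, -, -, -, hfwd, ⟨g, hg, hrev⟩, z, hz, hcyc⟩ :=
    exists_coherent_pair_envelope_class (W := W) hK hHN Dt H.dvd_sq_sub jbar hyp.ordinary hX9'.not_dvd_conductorNorm κ
      hγ (fun k ↦ hTw K p hp_odd hK κ hκ jbar k)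
      (card_ringClassGalOver_prime_one_of_frame hK hodd h3 hp hHp jbar) hyp.noPTorsion D
  have hfwd' : ((p : IwasawaAlgebra p) ^ 0) • heegnerModule D F₀ ≤ stabilizedHeegnerModule D C := by
    rw [pow_zero, one_smul]
    exact hfwd
  -- F-411 and CGLS Thm. 4.1.3 BY NAME; torsion of `𝔖 ⧸ Λκ_∞(C)` from `κ_∞ ≠ 0` and rank one
  have hKS' : thm411_exists_kolyvaginSystem_one_ne_zero := hKS
  have h413 : thm413_rankOne_charIdeal_torsion_dvd_localized.{0} := hCGLS
  obtain ⟨⟨hSfin, hS1⟩, -⟩ := h413 (W.conductorNorm ℤ) W K p κ γ jbar hyp D C X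
  haveI := hSfin
  obtain ⟨-, htorC⟩ := HeegnerStabilizedOfKSLeaf.torsionFree_and_isTorsion_quotient_of_kolyvaginSystemLeaf hKS' hyp jbar D C hz hcyc hS1
  obtain ⟨_, _, htorF, hloc⟩ := package_of_envelopeModules_of_isTorsion h413 hyp
    (Summit.BirchSwinnertonDyer.Rank1Residual.X9.selmerCorank_eq_one_of_rank_one hrk hfin) D C F₀ X hg hfwd' hrev htorC
  -- the μ-blind promotion by rescaling (landed stub of the v3 line)
  obtain ⟨F, hF⟩ := Summit.BirchSwinnertonDyer.BirchSwinnertonDyer.Theorems.PrintX9Rescaling.stub_rescaling W p K hX9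
    hK hodd h3 hHN hHp hirr κ hκ γ hγ jbar D F₀ X hSfin hS1 htorF hloc
  exact ⟨jbar, D, F, X, hF⟩

/-- **`HowardContainmentLightFrame` (24424) from the TWO `closes`-binders F-411 and CGLS Thm. 4.1.3** (the sharp tower is
the kernel theorem `Literature.NumberTheory.EllipticCurves.anticyclotomicTowerSharp`, x10b-p1-w2 p681041).
[cite: CastellaGrossiLeeSkinner2022, Thm. 4.1.1 (KS form), Thm. 4.1.3, Cor. 3.4.2, Rem. 4.1.4] -/
theorem howardContainmentLightFrame_of_kolyvaginSystemLeaf_of_cgls :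
    CGLSHeegnerKolyvaginSystem → CGLSHowardDivisibilityLocalized → HowardContainmentLightFrame :=
  fun hKS hCGLS ↦ howardContainmentLightFrame_of_kolyvaginSystemLeaf_of_towerSharp_of_cgls hKS
    Literature.NumberTheory.EllipticCurves.anticyclotomicTowerSharp hCGLS

/-- **THE WRITE-CRUX stmt-BirchSwinnertonDyer-25235 MODULO THE `closes`-BINDER F-411 ALONE**:
`CGLSHeegnerKolyvaginSystem → HowardContainmentLightFrameOfPrint`. Of the item's own three binders only `hCGLS` is used
(`hMZ` and the unsharp tower are idle); the missing non-vanishing input (LEAD g5 census, REF-117 class) is taken from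
F-411 instead of the extra leaf 27103. As filed the item stays open. [cite: CastellaGrossiLeeSkinner2022, Thm. 4.1.1 (KS form), Thm. 4.1.3, Rem. 4.1.4] -/
theorem howardContainmentLightFrameOfPrint_of_kolyvaginSystemLeaf :
    CGLSHeegnerKolyvaginSystem → HowardContainmentLightFrameOfPrint :=
  fun hKS _hMZ hCGLS _hTw ↦ howardContainmentLightFrame_of_kolyvaginSystemLeaf_of_cgls hKS hCGLS

/-! ## §4 The pinned side: `HowardContainmentLightFramePinned` from four `closes`-binders, no `hNV` -/

/-- **`HowardContainmentLightFramePinned` (stmt-BirchSwinnertonDyer-26356, the TIED light Howard containment `F.Dt = Dt`)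
from FOUR cite-only print leaves, all binders of `PrintX9.closes`: Howard 2004 Thm. 1.6.1 (F-161), CGLS 2022 Thm. 4.1.1 in
Kolyvagin-system form (F-411), Mastella–Zerman 2026 Cor. 4.6 (`hMZ`) and CGS 2025 Thm. 6.5.2 (`hCGS`) — WITHOUT the leaf
`CGLSHeegnerClassNonvanishing` (27103) and without the leaf G-2.4 (CG-FRAME).**  `p ∤ h_K`: MZ26 Cor. 4.6
(`PrintX9Rung.stmt_coprimeTied`).  `p ∣ h_K`: the engine's coherent pair WITH CLASS `(C₀, F₀, κ_∞)` on `(Dt, H.β)`; `κ_∞ ≠ 0`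
from F-411 (§1); `𝔖`, `𝒳` finitely generated and `𝔖` of rank one from `hCGS`, hence `𝔖 ⧸ Λκ_∞(C₀)` torsion; the specialised
witnesses at `(D, C₀, X, κ_∞)` by the landed KS-port `HeegnerMuPartOfPrintKS.portCyclic_of_ks` (F-161, F-411, the kernel
letters `howardInputs_holds` / `controlGlueKS_holds` and the frame-restricted Kummer = strict theorem
`kummerStrictOnFrames_holds`); the μ-inequality by `lengthAt_torsion_le_two_mul_of_hasSpecWitnesses`; then p624590 §2
verbatim (forward envelope `I(ℋ_F₀) ⊆ I(Λκ_∞(C₀))`, `(p^m)·I(Λκ_∞(C₀))² ⊆ char(𝒳_tors)` from CGS 6.5.2, promotion).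
CONDITIONAL on the four leaves; credits nothing by itself.
[cite: Howard2004HeegnerKolyvagin, Thm. 1.6.1, proof of Thm. 2.2.10, Thm. B] [cite: CastellaGrossiLeeSkinner2022, Thm. 4.1.1, Rem. 4.1.4]
[cite: CastellaGrossiSkinner2025, Thm. 6.5.2] [cite: MastellaZerman2026, Cor. 4.6] -/
theorem howardContainmentLightFramePinned_of_howard_kolyvaginSystem_mz_cgs :
    HowardDVRKolyvaginBound → CGLSHeegnerKolyvaginSystem → MastellaZermanHowardDivisibility →
      CGSHowardDivisibilityPLocalized → HowardContainmentLightFramePinned := by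
  intro h161 hKS hMZ hCGS W _ _ p _ _ K _ _ hX9 hK hodd h3 hHN hHp hirr κ hκ γ hγ Dt H ιC hc hrk hfin
  letI : Algebra K ℂ := ιC.toAlgebra
  let jbar : AlgebraicClosure K →+* ℂ :=
    (IsAlgClosed.lift (R := K) (M := ℂ) (S := AlgebraicClosure K)).toRingHom
  by_cases hhK : p ∣ NumberField.classNumber K
  · obtain ⟨D⟩ := LambdaAdicSelmerDataExists.nonempty_lambdaAdicSelmerData (W.baseChange K) p κ hγ
    obtain ⟨X⟩ := (W.baseChange K).nonempty_selmerDualData_holds κ γ hγ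
    have hp : p.Prime := Fact.out
    have hX9' := Summit.BirchSwinnertonDyer.BirchSwinnertonDyer.Rank1Residual.classX9_census_of_classX9 W p hX9
    have hp_odd : Odd p := hp.odd_of_ne_two hX9'.ne_two
    have hyp := Summit.BirchSwinnertonDyer.Rank1Residual.X9.thm413Hypotheses_of_lightFrame hX9' hK hodd h3 hHN
      hHp hκ hγ
    -- the core's strengthened μ-letter at `(Dt, H.β, D, X)`: the engine's coherent pair `(C, F)` with torsion and the
    -- μ-inequality granted rank one (F-161, F-411 BY NAME; CG-FRAME kernel letters inside)
    have h161' : thm161_dvrKolyvaginBound := h161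
    have hKS' : thm411_exists_kolyvaginSystem_one_ne_zero := hKS
    obtain ⟨C, F, -, hFDt, -, -, hfwd, ⟨g, hg, hrev⟩, htor_of, hμ_of⟩ :=
      HeegnerStabilizedOfKSLeaf.exists_coherentPair_isTorsion_muIneq_of_howard_kolyvaginSystem h161' hKS'
        (W.conductorNorm ℤ) W K p κ γ jbar hyp hX9'.not_hasCM hX9'.irr hirr hX9'.hasPadicScalarImage hHp hhK
        hX9'.not_dvd_conductorNorm (fun k ↦ Literature.NumberTheory.EllipticCurves.anticyclotomicTowerSharp K p hp_odd hK κ hκ jbar k)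
        (card_ringClassGalOver_prime_one_of_frame hK hodd h3 hp hHp jbar) Dt H.β H.dvd_sq_sub D X
    -- CGS Thm. 6.5.2 BY NAME at `(D, C, X)`: finiteness and `Λ`-rank one
    have h652 : CastellaGrossiSkinner2025.thm652_stabilized_rankOne_charIdeal_torsion_dvd_pLocalized.{0} := hCGS
    obtain ⟨⟨hfinS, hS1⟩, hfinX, -, -⟩ := h652 (W.conductorNorm ℤ) W K p κ γ jbar hyp D C X
    haveI := hfinS
    haveI := hfinX
    haveI : IsNoetherian (IwasawaAlgebra p) X.X := isNoetherian_of_isNoetherianRing_of_finite _ _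
    haveI : Module.Finite (IwasawaAlgebra p) (Submodule.torsion (IwasawaAlgebra p) X.X) := inferInstance
    haveI : Module.Finite (IwasawaAlgebra p) (D.S ⧸ stabilizedHeegnerModule D C) := inferInstance
    -- torsion of `𝔖 ⧸ Λκ_∞(C)` (from `κ_∞ ≠ 0` and rank one) and the μ-inequality at `(p)`
    obtain ⟨-, htorC⟩ := htor_of hfinS hS1
    have hμ := hμ_of hfinS hfinX hS1
    have htorF : Module.IsTorsion (IwasawaAlgebra p) (D.S ⧸ heegnerModule D F) :=
      isTorsion_quotient_heegnerModule_of_smul_stabilizedHeegnerModule_le D F C hg hrev htorC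
    -- `I(ℋ_F) ⊆ I(Λκ_C)` (forward envelope)
    have henv : heegnerCharIdeal D F ≤ stabilizedHeegnerCharIdeal D C :=
      heegnerCharIdeal_le_stabilizedHeegnerCharIdeal_of_le D F C htorF hfwd
    -- `(p^m) · I(Λκ_C)² ⊆ char(𝒳_tors)` (CGS 6.5.2 p-localized)
    obtain ⟨m, hm⟩ := CastellaGrossiSkinner2025.span_pow_mul_sq_le_charIdeal_torsion_of_thm652_stabilized h652
      hyp D C X
    have hC2 : stabilizedHeegnerCharIdeal D C ^ 2 ≤
        Module.charIdeal (IwasawaAlgebra p) (Submodule.torsion (IwasawaAlgebra p) X.X) := by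
      rw [stabilizedHeegnerCharIdeal_def] at hm ⊢
      exact IwasawaAlgebra.sq_charIdeal_le_charIdeal_of_span_p_pow_mul_le_of_lengthAt_le_two_mul
        (Submodule.torsion_isTorsion (R := IwasawaAlgebra p) (M := X.X)) htorC hμ hm
    exact ⟨jbar, D, F, X, hFDt, (Ideal.pow_right_mono henv 2).trans hC2⟩
  · obtain ⟨D, F, X, hF, hle⟩ := Summit.BirchSwinnertonDyer.BirchSwinnertonDyer.Theorems.PrintX9Rung.stmt_coprimeTied hMZ
      W p K hX9 hK hodd h3 hHN hHp hirr κ hκ γ hγ Dt H ιC jbar hc hrk hfin hhK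
    exact ⟨jbar, D, F, X, hF, hle⟩

/-- **The deciding crux decl `HowardContainmentLightFramePinnedOfPrintSharp` (stmt-BirchSwinnertonDyer-27077:
`hMZ → hNV → hCGS → hTw♯ → A^pin`) from F-161 and F-411, its binders `hNV` and `hTw♯` IDLE** — the by-name form of
`howardContainmentLightFramePinned_of_howard_kolyvaginSystem_mz_cgs` for the pen: in `PrintX9.closes` the term
`hG hM hH hK hCG hMZ hNV hCGS hTw` may be replaced by `(this) hH hK hMZ hNV hCGS hTw`, after which `hNV` (and `hCG`, `hM`, `hG`)
are no longer load-bearing. CONDITIONAL; no route verb is implied. [cite: Howard2004HeegnerKolyvagin, Thm. 1.6.1]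
[cite: CastellaGrossiLeeSkinner2022, Thm. 4.1.1, Rem. 4.1.4] [cite: CastellaGrossiSkinner2025, Thm. 6.5.2] [cite: MastellaZerman2026, Cor. 4.6] -/
theorem howardContainmentLightFramePinnedOfPrintSharp_of_howard_kolyvaginSystem :
    HowardDVRKolyvaginBound → CGLSHeegnerKolyvaginSystem → HowardContainmentLightFramePinnedOfPrintSharp :=
  fun h161 hKS hMZ _hNV hCGS _hTw ↦ howardContainmentLightFramePinned_of_howard_kolyvaginSystem_mz_cgs h161 hKS hMZ hCGS

/-! ## §5 Display: the X9 leaf from seven cite-only print leaves and the two K6 μ-inputs -/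

/-- **DISPLAY — `BSD_p` on the X9 leaf from SEVEN cite-only print leaves and the two K6 μ-inputs**: Howard 2004 Thm. 1.6.1
(F-161), CGLS 2022 Thm. 4.1.1 in Kolyvagin-system form (F-411), Mastella–Zerman 2026 Cor. 4.6, CGS 2025 Thm. 6.5.2, the pinned
transfer bundle `PinnedTransferPrintFacts`, `HeegnerPrintFactsX9`, `CyclotomicPrintFactsX9`, and `MuTransfer` /
`AnalyticMuZeroX9` (items 19629 / 19630).  The term of `PrintX9.closes` with the landed assembly
`TorsionLayerPinned.assemblyLightFramePinned_holds` (`hAsm`), the landed T-G′ door `PrintX9Pinned.twoSidedLinkPinnedOfPrint_holds`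
(`hB`) and §4 for the A-side; versus `PrintX9LeafOfPrintLeaves.bsdpOnClassX9_of_nineLeaves` the leaves G-2.4 (`hCG`, CG-FRAME,
LEAD g6) and CGLS 4.1.1-as-`∀ C`-value (`hNV`, this file) are gone.  CONDITIONAL on the nine hypotheses; a display, not a
closure. [cite: Howard2004HeegnerKolyvagin, Thm. 1.6.1, Thm. B] [cite: CastellaGrossiLeeSkinner2022, Thm. 4.1.1, Rem. 4.1.4]
[cite: CastellaGrossiSkinner2025, Thm. 6.5.2] [cite: MastellaZerman2026, Cor. 4.6] -/
theorem bsdpOnClassX9_of_sevenLeaves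
    (hH : HowardDVRKolyvaginBound) (hK : CGLSHeegnerKolyvaginSystem)
    (hMZ : MastellaZermanHowardDivisibility) (hCGS : CGSHowardDivisibilityPLocalized) (hPT : PinnedTransferPrintFacts)
    (hHP : HeegnerPrintFactsX9) (hCP : CyclotomicPrintFactsX9)
    (hT : MuTransfer) (hμ : AnalyticMuZeroX9) :
    Summit.BirchSwinnertonDyer.BirchSwinnertonDyer.Rank1Residual.BSDpOnClassX9 :=
  Summit.BirchSwinnertonDyer.BirchSwinnertonDyer.Rank1Residual.TorsionLayerPinned.assemblyLightFramePinned_holds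
    (howardContainmentLightFramePinned_of_howard_kolyvaginSystem_mz_cgs hH hK hMZ hCGS)
    (Summit.BirchSwinnertonDyer.BirchSwinnertonDyer.Theorems.PrintX9Pinned.twoSidedLinkPinnedOfPrint_holds hPT hHP)
    hT hμ hHP hCP

end Summit.BirchSwinnertonDyer.BirchSwinnertonDyer.Theorems.PrintX9OfKolyvaginSystemLeaf

end
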